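import Summits.Ventures.CertifiedArithmetic.LowPrec.SRCoupledBlockError
import HarnessLib

/-!
# Stochastic rounding in low-precision formats LXIV — ONE RANDOM DRAW PER BLOCK (iii): WHICH COUPLING
# FOR WHICH FUNCTIONAL.  The prefix scan minimises EVERY convex functional of the number of
# up-roundings (equal gaps: of the block-sum error) among ALL randomised schemes with an unbiased
# count; for sign-indefinite functionals NO coupling beats independent SR, and the prefix scan loses
# a factor `n`

HONEST FRAMING: certified error envelopes and provably optimal rounding/accumulation schemes for
low-precision formats under stated cost models; every table by two implementations; no hardware or
vendor claims.

Setting of files LXII–LXIII (`LowPrec/SRCoupledBlock`, `…BlockError`).  A RANDOMISED ROUNDING SCHEME of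
a block is any finitely supported law: outcomes `ω ∈ s`, weights `w ω ≥ 0`, `∑ w = 1`; it produces
rounding bits `bᵢ(ω) ∈ {0,1}` and the count `S(ω) = #{i : bᵢ(ω) = 1}`.  Independent SR, the prefix scan
of file LXII, pairwise-independent hashing schemes, any dithering — all are instances.
1. CONVEX ORDER (`natCast_sub_mul_sub_nonneg`, `dconvex_support`, `law_dconvex_ge`): for every scheme
   whose count has mean `μ`, every `q ∈ ℕ` and every discretely convex `f : ℕ → K`
   (`f(s+1) − f(s) ≤ f(s+2) − f(s+1)`): `f(q) + (μ − q)(f(q+1) − f(q)) ≤ E f(S)`; variance form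
   (`law_var_count_ge`): `(μ − q)(q + 1 − μ) ≤ Var S`.  The prefix scan ATTAINS the left sides at
   `q = ⌊Cₙ/m⌋` (`sys_fun_cnt_eq`, `sys_var_eq`), hence (`sys_optimal_dconvex`): among all schemes with
   unbiased count — in particular all couplings with the exact `SR_N` marginals — ONE SHARED DRAW
   MINIMISES EVERY CONVEX FUNCTIONAL OF THE COUNT (variance, all moments `E|S − μ|ᵖ`, exponential
   moments), i.e. of the block-sum error when the gaps are equal (file LXIII `blockErr_const`).
2. SURE RANGE (`law_exists_ge`, `law_exists_le`): every scheme with `E S = μ`, `q < μ < q + 1`, puts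
   positive weight on `S ≥ q + 1` AND on `S ≤ q`: nobody's sure deviations are smaller than the prefix
   scan's `{−(μ − q), q + 1 − μ}` (file LXII `disc_eq_ite`).
3. THE OTHER SIDE — SIGN-INDEFINITE FUNCTIONALS.  For errors `aᵢ = Gᵢ(bᵢ − θᵢ)` with the SR marginals,
   `E aᵢ² = Gᵢ²θᵢ(1−θᵢ)` whatever the coupling (`law_err_sq`).  Parseval on the cube
   (`sum_powerset_sq`: `∑_{A ⊆ s} (∑_{i∈s} ±_A aᵢ)² = 2^{#s} ∑ aᵢ²`) gives (`exists_sign_mse_ge`): for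
   EVERY scheme there is a sign pattern `A` with `E(∑ᵢ ±_A aᵢ)² ≥ ∑ Gᵢ²θᵢ(1−θᵢ) =: V_ind`, while any
   scheme with pairwise-uncorrelated errors (independent SR; pairwise-independent draws) has
   `E(∑ cᵢaᵢ)² = ∑ cᵢ² E aᵢ²`, `= V_ind` for every sign pattern (`uncorrelated_mse_eq`): INDEPENDENT SR
   IS MINIMAX over sign patterns, and no coupling improves all signed sums at once.  The prefix scan is
   far from minimax: at `θ ≡ 1/2`, `N = 1`, equal gaps `g`, its alternating-sign error is `± n·g/2`
   SURELY (`sysUp_half`, `sys_alternating_sq`) — mean square `n²g²/4` against `n·g²/4` independent.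
4. FP4 LEDGER (`FP4.coupling_table`, E2M1 cell `[1, 3/2]`, four elements `5/4`, `N = 1`): block SUM —
   prefix scan `E e² = 0` (exact: `C₄ = 4 ≡ 0 mod 2`) vs independent `1/4`; ALTERNATING sum — prefix
   scan `1` (surely `±1`) vs independent `1/4`.
So the design rule under the random-bit cost model is by functional: one shared draw per block for
block sums / dot-product partial sums (files LXII–LXIII: `n`-free laws, optimal here), independent (or
pairwise-independent) draws when arbitrary signed combinations of the same rounded block are consumed.
NOT CLAIMED: uniqueness of the minimax schemes; anything for recursive accumulation; mixed functionals.
Prior art: convex-order minimality of SR for ONE rounding is file LV (`step_le_law`); minimum-variance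
integer-valued unbiased estimators with two-point support are classical (systematic sampling
[Madow1949]; dependent randomized rounding [DoerrEtAl2006, Thm. 3]); [SureshEtAl2022, Thm. 4–5] prove
lower bounds for OBLIVIOUS distributed quantisers, a different class.  The dichotomy 1–3 for couplings of
floating-point stochastic roundings is new as far as searched (FRESHNESS-SR K).
-/

namespace Summit.Ventures.CertifiedArithmetic.LowPrec.SR

open Finset

namespace Coupled

section Law

variable {K : Type*} [Field K] [LinearOrder K] [IsStrictOrderedRing K]

/-! ### Convex order: two-point laws on consecutive integers are minimal -/

/-- Integers avoid open unit cells: `(k − q)(k − q − 1) ≥ 0` for naturals `k, q`. -/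
theorem natCast_sub_mul_sub_nonneg (k q : ℕ) : 0 ≤ ((k : K) - q) * ((k : K) - q - 1) := by
  rcases Nat.lt_or_ge k (q + 1) with h | h
  · have hk : (k : K) ≤ q := by exact_mod_cast Nat.lt_succ_iff.mp h
    exact mul_nonneg_of_nonpos_of_nonpos (by linarith) (by linarith)
  · have hk : (q : K) + 1 ≤ k := by exact_mod_cast h
    exact mul_nonneg (by linarith) (by linarith)

/-- **Variance of an unbiased integer count.**  For ANY finitely supported law of a natural-number
count `S` with mean `μ` and any `q ∈ ℕ`: `(μ − q)(q + 1 − μ) ≤ ∑ w (S − μ)²` (best at `q = ⌊μ⌋`: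
`φ(1−φ)`, `φ = μ − ⌊μ⌋`). [classical] -/
theorem law_var_count_ge {Ω : Type*} (s : Finset Ω) {w : Ω → K} (hw : ∀ ω ∈ s, 0 ≤ w ω)
    (h1 : ∑ ω ∈ s, w ω = 1) (S : Ω → ℕ) {μ : K} (hμ : ∑ ω ∈ s, w ω * (S ω : K) = μ) (q : ℕ) :
    (μ - q) * (q + 1 - μ) ≤ ∑ ω ∈ s, w ω * ((S ω : K) - μ) ^ 2 := by
  have e : ∀ ω, w ω * ((S ω : K) - μ) ^ 2 = w ω * (((S ω : K) - q) * ((S ω : K) - q - 1))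
      + (2 * q + 1 - 2 * μ) * (w ω * (S ω : K)) + (μ ^ 2 - q * (q + 1)) * w ω := fun ω => by ring
  have hid : ∑ ω ∈ s, w ω * ((S ω : K) - μ) ^ 2
      = ∑ ω ∈ s, w ω * (((S ω : K) - q) * ((S ω : K) - q - 1)) + (μ - q) * (q + 1 - μ) := by
    simp_rw [e, sum_add_distrib, ← mul_sum, h1, hμ]; ring
  have hnn : 0 ≤ ∑ ω ∈ s, w ω * (((S ω : K) - q) * ((S ω : K) - q - 1)) :=
    sum_nonneg fun ω hω => mul_nonneg (hw ω hω) (natCast_sub_mul_sub_nonneg _ _)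
  linarith

/-- Supporting line of a discretely convex `f : ℕ → K` through `(q, f q)` and `(q+1, f(q+1))`:
`f(q) + (k − q)(f(q+1) − f(q)) ≤ f(k)` for all naturals `k`. -/
theorem dconvex_support {f : ℕ → K} (hf : ∀ s, f (s + 1) - f s ≤ f (s + 2) - f (s + 1)) (q k : ℕ) :
    f q + ((k : K) - q) * (f (q + 1) - f q) ≤ f k := by
  have hmono : Monotone fun s => f (s + 1) - f s := monotone_nat_of_le_succ fun s => hf s
  rcases Nat.le_total q k with h | h
  · obtain ⟨d, rfl⟩ := Nat.exists_eq_add_of_le h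
    have htel := Finset.sum_range_sub (fun j => f (q + j)) d
    simp only [add_zero] at htel
    have hge : ∑ j ∈ range d, (f (q + 1) - f q) ≤ ∑ j ∈ range d, (f (q + (j + 1)) - f (q + j)) :=
      sum_le_sum fun j _ => by simpa [add_assoc] using hmono (Nat.le_add_right q j)
    rw [sum_const, card_range, nsmul_eq_mul, htel] at hge
    push_cast
    linarith
  · obtain ⟨d, rfl⟩ := Nat.exists_eq_add_of_le h
    have htel := Finset.sum_range_sub (fun j => f (k + j)) d
    simp only [add_zero] at htel
    have hle : ∑ j ∈ range d, (f (k + (j + 1)) - f (k + j))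
        ≤ ∑ j ∈ range d, (f (k + d + 1) - f (k + d)) :=
      sum_le_sum fun j hj => by
        simpa [add_assoc] using hmono (show k + j ≤ k + d by have := mem_range.mp hj; omega)
    rw [htel, sum_const, card_range, nsmul_eq_mul] at hle
    push_cast
    linarith

/-- **Every convex functional of an unbiased integer count lies above the chord at its mean.**  For any
finitely supported law of a natural count `S` with mean `μ`, any discretely convex `f` and any `q ∈ ℕ`:
`f(q) + (μ − q)(f(q+1) − f(q)) ≤ ∑ w f(S)`.  For `q ≤ μ ≤ q + 1` the left side is `E f` under the
two-point law `{q ↦ q+1−μ, q+1 ↦ μ−q}`. [classical; cf. file LV `step_le_law` for one rounding] -/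
theorem law_dconvex_ge {Ω : Type*} (s : Finset Ω) {w : Ω → K} (hw : ∀ ω ∈ s, 0 ≤ w ω)
    (h1 : ∑ ω ∈ s, w ω = 1) (S : Ω → ℕ) {μ : K} (hμ : ∑ ω ∈ s, w ω * (S ω : K) = μ) {f : ℕ → K}
    (hf : ∀ s, f (s + 1) - f s ≤ f (s + 2) - f (s + 1)) (q : ℕ) :
    f q + (μ - q) * (f (q + 1) - f q) ≤ ∑ ω ∈ s, w ω * f (S ω) := by
  have e : ∀ ω, w ω * (f q + ((S ω : K) - q) * (f (q + 1) - f q))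
      = (f q - q * (f (q + 1) - f q)) * w ω + (f (q + 1) - f q) * (w ω * (S ω : K)) := fun ω => by
    ring
  have lhs : ∑ ω ∈ s, w ω * (f q + ((S ω : K) - q) * (f (q + 1) - f q))
      = f q + (μ - q) * (f (q + 1) - f q) := by
    simp_rw [e, sum_add_distrib, ← mul_sum, h1, hμ]; ring
  rw [← lhs]
  exact sum_le_sum fun ω hω => mul_le_mul_of_nonneg_left (dconvex_support hf q (S ω)) (hw ω hω)

/-- **The prefix scan attains the chord**: `(1/m)∑_R f(⌊(Cₙ+R)/m⌋) = f(q) + (μ − q)(f(q+1) − f(q))`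
with `μ = Cₙ/m = ∑θᵢ` the mean count and `q = ⌊μ⌋`. -/
theorem sys_fun_cnt_eq {m : ℕ} (hm : 0 < m) (t : ℕ → ℕ) (n : ℕ) (f : ℕ → K) :
    (∑ R ∈ range m, f (cnt m t R n)) / m
      = f (pre t n / m) + ((pre t n : K) / m - (pre t n / m : ℕ)) * (f (pre t n / m + 1)
          - f (pre t n / m)) := by
  have hm' : (m : K) ≠ 0 := by exact_mod_cast hm.ne'
  have hr : pre t n % m ≤ m := (Nat.mod_lt _ hm).le
  have hC : (pre t n : K) = (m : K) * ((pre t n / m : ℕ) : K) + ((pre t n % m : ℕ) : K) := by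
    exact_mod_cast (Nat.div_add_mod (pre t n) m).symm
  rw [sum_fun_cnt hm t n f]
  simp only [nsmul_eq_mul]
  push_cast [Nat.cast_sub hr]
  rw [hC]
  field_simp
  ring

/-- **The prefix scan's count variance is the floor value** `(μ − q)(q + 1 − μ)`, `q = ⌊μ⌋`
(file LXII `sum_disc_sq` rewritten). -/
theorem sys_var_eq {m : ℕ} (hm : 0 < m) (t : ℕ → ℕ) (n : ℕ) :
    (∑ R ∈ range m, (disc K m t R n) ^ 2) / m
      = ((pre t n : K) / m - (pre t n / m : ℕ)) * ((pre t n / m : ℕ) + 1 - (pre t n : K) / m) := by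
  have hm' : (m : K) ≠ 0 := by exact_mod_cast hm.ne'
  have hC : (pre t n : K) = (m : K) * ((pre t n / m : ℕ) : K) + ((pre t n % m : ℕ) : K) := by
    exact_mod_cast (Nat.div_add_mod (pre t n) m).symm
  rw [sum_disc_sq hm t n, hC]
  field_simp
  ring

/-- **OPTIMALITY OF ONE SHARED DRAW FOR THE COUNT.**  For every randomised rounding scheme of the
block whose number of up-roundings `S` is unbiased (`E S = Cₙ/m = ∑θᵢ`; in particular every coupling
with the exact `SR` marginals) and every discretely convex `f`: `E_prefix-scan f(count) ≤ E_scheme f(S)`.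
With equal gaps the block-sum error is `g·(count − ∑θᵢ)` (file LXIII `blockErr_const`), so the prefix
scan minimises every convex functional of the block-sum error. [new] -/
theorem sys_optimal_dconvex {Ω : Type*} (s : Finset Ω) {w : Ω → K} (hw : ∀ ω ∈ s, 0 ≤ w ω)
    (h1 : ∑ ω ∈ s, w ω = 1) (S : Ω → ℕ) {m : ℕ} (hm : 0 < m) (t : ℕ → ℕ) (n : ℕ)
    (hμ : ∑ ω ∈ s, w ω * (S ω : K) = (pre t n : K) / m) {f : ℕ → K}
    (hf : ∀ s, f (s + 1) - f s ≤ f (s + 2) - f (s + 1)) :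
    (∑ R ∈ range m, f (cnt m t R n)) / m ≤ ∑ ω ∈ s, w ω * f (S ω) := by
  rw [sys_fun_cnt_eq hm t n f]
  exact law_dconvex_ge s hw h1 S hμ hf (pre t n / m)

/-! ### Sure range: nobody deviates less than the prefix scan -/

/-- If `E S = μ > q` then some outcome of positive weight has `S ≥ q + 1`. -/
theorem law_exists_ge {Ω : Type*} (s : Finset Ω) {w : Ω → K} (hw : ∀ ω ∈ s, 0 ≤ w ω)
    (h1 : ∑ ω ∈ s, w ω = 1) (S : Ω → ℕ) {μ : K} (hμ : ∑ ω ∈ s, w ω * (S ω : K) = μ) {q : ℕ}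
    (hq : (q : K) < μ) : ∃ ω ∈ s, 0 < w ω ∧ q + 1 ≤ S ω := by
  by_contra h
  have hS : ∀ ω ∈ s, 0 < w ω → S ω ≤ q := fun ω hω hpos => by
    by_contra hc
    exact h ⟨ω, hω, hpos, by omega⟩
  have hle : μ ≤ q := by
    rw [← hμ]
    calc ∑ ω ∈ s, w ω * (S ω : K) ≤ ∑ ω ∈ s, w ω * (q : K) := by
          refine sum_le_sum fun ω hω => ?_
          rcases (hw ω hω).eq_or_lt with h0 | hpos
          · rw [← h0]; simp
          · exact mul_le_mul_of_nonneg_left (by exact_mod_cast hS ω hω hpos) (hw ω hω)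
      _ = q := by rw [← sum_mul, h1, one_mul]
  exact absurd hq (not_lt.mpr hle)

/-- If `E S = μ < q + 1` then some outcome of positive weight has `S ≤ q`. -/
theorem law_exists_le {Ω : Type*} (s : Finset Ω) {w : Ω → K} (hw : ∀ ω ∈ s, 0 ≤ w ω)
    (h1 : ∑ ω ∈ s, w ω = 1) (S : Ω → ℕ) {μ : K} (hμ : ∑ ω ∈ s, w ω * (S ω : K) = μ) {q : ℕ}
    (hq : μ < q + 1) : ∃ ω ∈ s, 0 < w ω ∧ S ω ≤ q := by
  by_contra h
  have hS : ∀ ω ∈ s, 0 < w ω → q + 1 ≤ S ω := fun ω hω hpos => by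
    by_contra hc
    exact h ⟨ω, hω, hpos, by omega⟩
  have hle : (q : K) + 1 ≤ μ := by
    rw [← hμ]
    calc (q : K) + 1 = ∑ ω ∈ s, w ω * ((q : K) + 1) := by rw [← sum_mul, h1, one_mul]
      _ ≤ ∑ ω ∈ s, w ω * (S ω : K) := by
          refine sum_le_sum fun ω hω => ?_
          rcases (hw ω hω).eq_or_lt with h0 | hpos
          · rw [← h0]; simp
          · exact mul_le_mul_of_nonneg_left (by exact_mod_cast hS ω hω hpos) (hw ω hω)
  exact absurd hq (not_lt.mpr hle)

/-! ### Sign-indefinite functionals: no coupling beats independent SR -/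

omit [LinearOrder K] [IsStrictOrderedRing K] in
/-- **Parseval on the cube.**  Summing over all sign patterns `A ⊆ s` (`+` on `A`, `−` off `A`):
`∑_A (∑_{i∈s} ±_A aᵢ)² = 2^{#s}·∑_{i∈s} aᵢ²`. -/
theorem sum_powerset_sq {ι : Type*} [DecidableEq ι] (s : Finset ι) (a : ι → K) :
    ∑ A ∈ s.powerset, (∑ i ∈ s, if i ∈ A then a i else -a i) ^ 2 = 2 ^ s.card * ∑ i ∈ s, a i ^ 2 := by
  induction s using Finset.induction_on with
  | empty => simp
  | insert j s hj ih =>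
    rw [sum_powerset_insert hj, card_insert_of_notMem hj, sum_insert hj]
    have e1 : ∑ A ∈ s.powerset, (∑ i ∈ insert j s, if i ∈ A then a i else -a i) ^ 2
        = ∑ A ∈ s.powerset, (-a j + ∑ i ∈ s, if i ∈ A then a i else -a i) ^ 2 := by
      refine sum_congr rfl fun A hA => ?_
      have hjA : j ∉ A := fun h => hj (mem_powerset.mp hA h)
      rw [sum_insert hj, if_neg hjA]
    have e2 : ∑ A ∈ s.powerset, (∑ i ∈ insert j s, if i ∈ insert j A then a i else -a i) ^ 2
        = ∑ A ∈ s.powerset, (a j + ∑ i ∈ s, if i ∈ A then a i else -a i) ^ 2 := by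
      refine sum_congr rfl fun A _ => ?_
      rw [sum_insert hj, if_pos (mem_insert_self j A)]
      congr 2
      refine sum_congr rfl fun i hi => ?_
      have hij : i ≠ j := fun h => hj (h ▸ hi)
      simp [mem_insert, hij]
    have e3 : ∀ A : Finset ι, (-a j + ∑ i ∈ s, if i ∈ A then a i else -a i) ^ 2
        + (a j + ∑ i ∈ s, if i ∈ A then a i else -a i) ^ 2
        = 2 * a j ^ 2 + 2 * (∑ i ∈ s, if i ∈ A then a i else -a i) ^ 2 := fun A => by ring
    rw [e1, e2, ← sum_add_distrib, sum_congr rfl fun A _ => e3 A, sum_add_distrib, sum_const,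
      card_powerset, ← mul_sum, ih, nsmul_eq_mul]
    push_cast
    ring

variable {Ω : Type*}

/-- Second moment of ONE rounding error `aᵢ = Gᵢ(bᵢ − θᵢ)`, `bᵢ ∈ {0,1}`, `E bᵢ = θᵢ`:
`E aᵢ² = Gᵢ²θᵢ(1−θᵢ)` — the same for every coupling. -/
theorem law_err_sq (s : Finset Ω) {w : Ω → K} (h1 : ∑ ω ∈ s, w ω = 1) {b : Ω → K}
    (hb : ∀ ω ∈ s, b ω = 0 ∨ b ω = 1) {θ : K} (hθ : ∑ ω ∈ s, w ω * b ω = θ) (G : K) :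
    ∑ ω ∈ s, w ω * (G * (b ω - θ)) ^ 2 = G ^ 2 * (θ * (1 - θ)) := by
  have e : ∀ ω ∈ s, w ω * (G * (b ω - θ)) ^ 2
      = (G ^ 2 * (1 - 2 * θ)) * (w ω * b ω) + (G ^ 2 * θ ^ 2) * w ω := by
    intro ω hω
    have hb2 : b ω ^ 2 = b ω := by rcases hb ω hω with h | h <;> simp [h]
    linear_combination (G ^ 2 * w ω) * hb2
  rw [sum_congr rfl e, sum_add_distrib, ← mul_sum, ← mul_sum, hθ, h1]
  ring

/-- **No coupling beats `V_ind` on all signed sums.**  For EVERY scheme with the SR marginals there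
is a sign pattern `A ⊆ {0,…,n−1}` with `E(∑ᵢ ±_A Gᵢ(bᵢ − θᵢ))² ≥ ∑ᵢ Gᵢ²θᵢ(1−θᵢ)`. [new] -/
theorem exists_sign_mse_ge (s : Finset Ω) {w : Ω → K} (h1 : ∑ ω ∈ s, w ω = 1)
    {b : ℕ → Ω → K} (hb : ∀ i, ∀ ω ∈ s, b i ω = 0 ∨ b i ω = 1)
    {θ : ℕ → K} (hθ : ∀ i, ∑ ω ∈ s, w ω * b i ω = θ i) (G : ℕ → K) (n : ℕ) :
    ∃ A ∈ (range n).powerset, ∑ i ∈ range n, G i ^ 2 * (θ i * (1 - θ i))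
      ≤ ∑ ω ∈ s, w ω * (∑ i ∈ range n,
          if i ∈ A then G i * (b i ω - θ i) else -(G i * (b i ω - θ i))) ^ 2 := by
  have key : ∀ ω, ∑ A ∈ (range n).powerset,
      (∑ i ∈ range n, if i ∈ A then G i * (b i ω - θ i) else -(G i * (b i ω - θ i))) ^ 2
        = 2 ^ n * ∑ i ∈ range n, (G i * (b i ω - θ i)) ^ 2 := fun ω => by
    simpa using sum_powerset_sq (range n) (fun i => G i * (b i ω - θ i))
  refine exists_le_of_sum_le ⟨∅, empty_mem_powerset _⟩ (le_of_eq ?_)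
  calc ∑ _A ∈ (range n).powerset, ∑ i ∈ range n, G i ^ 2 * (θ i * (1 - θ i))
      = 2 ^ n * ∑ i ∈ range n, ∑ ω ∈ s, w ω * (G i * (b i ω - θ i)) ^ 2 := by
        rw [sum_const, card_powerset, card_range, nsmul_eq_mul,
          sum_congr rfl fun i _ => (law_err_sq s h1 (hb i) (hθ i) (G i)).symm]
        push_cast
        ring
    _ = ∑ ω ∈ s, w ω * (2 ^ n * ∑ i ∈ range n, (G i * (b i ω - θ i)) ^ 2) := by
        simp_rw [mul_sum]
        rw [sum_comm]
        exact sum_congr rfl fun ω _ => sum_congr rfl fun i _ => by ring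
    _ = ∑ ω ∈ s, w ω * ∑ A ∈ (range n).powerset, (∑ i ∈ range n,
          if i ∈ A then G i * (b i ω - θ i) else -(G i * (b i ω - θ i))) ^ 2 :=
        sum_congr rfl fun ω _ => by rw [key ω]
    _ = _ := by simp_rw [mul_sum]; rw [sum_comm]

omit [LinearOrder K] [IsStrictOrderedRing K] in
/-- **Pairwise-uncorrelated errors are exactly additive in mean square**: if `E aᵢaⱼ = 0` for
`i ≠ j` then `E(∑ cᵢaᵢ)² = ∑ cᵢ²·E aᵢ²` for every coefficient vector — with the SR marginals,
`∑ cᵢ²Gᵢ²θᵢ(1−θᵢ)`, i.e. `V_ind` for every sign pattern: independent (or pairwise-independent) SR is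
minimax over signed sums. -/
theorem uncorrelated_mse_eq (s : Finset Ω) (w : Ω → K) (a : ℕ → Ω → K) (n : ℕ)
    (hcov : ∀ i ∈ range n, ∀ j ∈ range n, i ≠ j → ∑ ω ∈ s, w ω * (a i ω * a j ω) = 0)
    (c : ℕ → K) :
    ∑ ω ∈ s, w ω * (∑ i ∈ range n, c i * a i ω) ^ 2
      = ∑ i ∈ range n, c i ^ 2 * ∑ ω ∈ s, w ω * a i ω ^ 2 := by
  have e : ∀ ω, w ω * (∑ i ∈ range n, c i * a i ω) ^ 2
      = ∑ i ∈ range n, ∑ j ∈ range n, (c i * c j) * (w ω * (a i ω * a j ω)) := by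
    intro ω
    rw [sq, sum_mul_sum, mul_sum]
    exact sum_congr rfl fun i _ => by rw [mul_sum]; exact sum_congr rfl fun j _ => by ring
  simp_rw [e]
  rw [sum_comm]
  refine sum_congr rfl fun i hi => ?_
  rw [sum_comm]
  simp_rw [← mul_sum]
  rw [sum_eq_single_of_mem i hi fun j hj hne => by rw [hcov i hi j hj hne.symm, mul_zero], sq]
  congr 1
  exact sum_congr rfl fun ω _ => by ring

/-! ### The prefix scan on an alternating functional: a factor `n` worse -/

/-- At `θ ≡ 1/2`, `N = 1` the prefix scan alternates: `Bᵢ(R) = (i + R) mod 2`. -/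
theorem sysUp_half (R i : ℕ) : sysUp 2 (fun _ => 1) R i = (i + R) % 2 := by
  simp only [sysUp, cnt, pre, sum_const, card_range, smul_eq_mul, mul_one]
  omega

/-- … so the alternating-sign error with equal gaps `g` is `n·g·(R − 1/2) = ∓ n·g/2` SURELY, of mean
square `n²g²/4` — against `n·g²/4` for independent SR (`uncorrelated_mse_eq`). [new] -/
theorem sys_alternating_sq {R : ℕ} (hR : R < 2) (g : K) (n : ℕ) :
    (∑ i ∈ range n, (-1 : K) ^ i * (g * ((sysUp 2 (fun _ => 1) R i : K) - 1 / 2))) ^ 2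
      = (n : K) ^ 2 * g ^ 2 / 4 := by
  have hterm : ∀ i, (-1 : K) ^ i * (g * ((sysUp 2 (fun _ => 1) R i : K) - 1 / 2))
      = g * ((R : K) - 1 / 2) := by
    intro i
    rw [sysUp_half R i]
    rcases Nat.even_or_odd i with hi | hi
    · rw [hi.neg_one_pow]
      interval_cases R
      · rw [show (i + 0) % 2 = 0 by obtain ⟨k, rfl⟩ := hi; omega]; simp
      · rw [show (i + 1) % 2 = 1 by obtain ⟨k, rfl⟩ := hi; omega]; simp
    · rw [hi.neg_one_pow]
      interval_cases R
      · rw [show (i + 0) % 2 = 1 by obtain ⟨k, rfl⟩ := hi; omega]; push_cast; ring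
      · rw [show (i + 1) % 2 = 0 by obtain ⟨k, rfl⟩ := hi; omega]; push_cast; ring
  simp_rw [hterm, sum_const, card_range, nsmul_eq_mul]
  have hsq : ((R : K) - 1 / 2) ^ 2 = 1 / 4 := by
    interval_cases R <;> norm_num
  rw [mul_pow, mul_pow, hsq]
  ring

end Law

end Coupled

/-! ### FP4 ledger: which coupling for which functional -/

namespace FP4

open Coupled

/-- **E2M1, four elements `5/4` (cell `[1, 3/2]`, `g = 1/2`, `θ = 1/2`), one shared bit (`N = 1`).**
Block SUM: the prefix scan is EXACT on both draws (`C₄ = 4 ≡ 0 mod 2`), independent SR has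
`E e² = 4·g²/4 = 1/4`.  ALTERNATING sum: the prefix scan errs by `±1` surely (mean square `1`),
independent SR has `1/4`.  Neither coupling dominates; the functional decides. -/
theorem coupling_table :
    (1 : ℚ) ∈ e2m1 ∧ (3 / 2 : ℚ) ∈ e2m1 ∧ (1 : ℚ) + 1 / 2 * (1 / 2) = 5 / 4 ∧
    (∀ R < 2, blockErr 2 (fun _ => 1) (fun _ => (1 / 2 : ℚ)) R 4 = 0) ∧
    (4 : ℚ) * ((1 / 2) ^ 2 * (1 / 2 * (1 - 1 / 2))) = 1 / 4 ∧
    (∀ R < 2, (∑ i ∈ range 4, (-1 : ℚ) ^ i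
        * ((1 / 2 : ℚ) * ((sysUp 2 (fun _ => 1) R i : ℚ) - 1 / 2))) ^ 2 = 1) := by
  refine ⟨by decide +kernel, by decide +kernel, by norm_num, ?_, by norm_num, ?_⟩
  · intro R hR
    interval_cases R <;>
      · simp only [blockErr, sum_range_succ, sum_range_zero, sysUp, cnt, pre]; norm_num
  · intro R hR
    rw [sys_alternating_sq hR]
    norm_num

end FP4

end Summit.Ventures.CertifiedArithmetic.LowPrec.SR
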